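import Mathlib
import HarnessLib
import Summits.NavierStokesRegularity.NavierStokesRegularity.Theorems.UnthreadedDoorCellFluxClusterFluxLeVorticity
import Summits.NavierStokesRegularity.NavierStokesRegularity.Theorems.UnthreadedDoorCellFluxNetFluxLeClusterFlux
import Summits.NavierStokesRegularity.NavierStokesRegularity.Theorems.UnthreadedDoorNetFluxWindowDecayViscosity
import Summits.NavierStokesRegularity.NavierStokesRegularity.Theorems.UnthreadedDoorNetFluxNearCentreFlux
import Summits.NavierStokesRegularity.NavierStokesRegularity.Theorems.UnthreadedDoorNetFluxEnvelopeRegularity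

/-!
# Route `UnthreadedDoor`, crux `PoloidalLiouville` (stmt-NavierStokesRegularity-1222), WALL W1 — crux idea «cell-flux», Σ-3′ tooling:
# the a-priori growth bound of the cluster flux of an admissible rule on the whole window

Inputs of the Σ-3′ re-run (`Theorems/UnthreadedDoorCellFluxWindowDecayOffNullInt.lean`) that are NOT verbatim AE-4′:

* `clusterFlux_nonneg_of_partition` — `0 ≤ clusterFlux f r 𝒦` on a cluster partition (`0 ≤ netFlux ≤ clusterFlux`, p722300);
* `slab_subset_closure_counted` — under `cellPred N₀ D` at every window time with `volume D = 0`, the COUNTED points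
  `{(t,r) | t ∉ D, finitely many cells on S_r(x₀) for T(t), at most N₀}` are dense in the window slab `]t₀,0[ × ]0,∞[`
  (good times off the null `D`, then good radii off the null `B_t` of `cellTamePred`);
* ★ `clusterFlux_window_growth` — for every admissible rule `𝒞` of data with `‖curl v(t)‖ ≤ C₁/(−t)` and the link:
  `0 ≤ clusterFlux (T t) r (𝒞 t r) ≤ N₀ π C₁ r/(−t)` at EVERY `(t,r)` of the slab: Σ-0a `ClusterFluxLeVorticity` (as a hypothesis; it is
  ns-qj-p1 g7's `CellFlux.clusterFluxLeVorticity`, p717414) with `≤ N₀` classes on the counted points (clause 4 of `AdmissibleRule`), upgraded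
  to every point by the JOINT CONTINUITY of the rule's flux (clause 3) via `le_on_closure` on a box whose closure stays inside the slab
  (pattern of ARM A's `clusterFlux_nearCentre_cap`, p718757).

Pure bookkeeping/real analysis under crux 1222 (OPEN); nothing here is an NS statement; W1 / NS regularity NOT proved.
`--supports stmt-NavierStokesRegularity-1222 --as helper`.  [folklore]
-/

noncomputable section

-- the summit and its single sub-problem share the name (CONVENTIONS §1)
set_option linter.dupNamespace false

open Set Function Filter Topology MeasureTheory
open scoped RealInnerProductSpace ENNReal

namespace Summit.NavierStokesRegularity.NavierStokesRegularity.Theorems.PoloidalLiouville.CellFlux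

open Summit.NavierStokesRegularity.NavierStokesRegularity.Theorems.PoloidalLiouville.NetFlux
  (E3 netFlux sphOsc contDiff_slice_of_window contDiffOn_slice_compl sphOsc_nonneg_offCentre)
open Literature.Analysis Literature.Analysis.FluidPDE

variable {v : ℝ → E3 → E3} {T P : ℝ → E3 → ℝ} {V : ℝ → ℝ} {x₀ : E3} {t₀ : ℝ} {N₀ : ℕ} {D : Set ℝ}

/-- `0 ≤ clusterFlux f r 𝒦` on a cluster partition of `S_r(x₀)`, `r > 0`, `f ∈ C¹({x₀}ᶜ)` (`0 ≤ netFlux ≤ clusterFlux`). [folklore] -/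
theorem clusterFlux_nonneg_of_partition {f : E3 → ℝ} {r : ℝ} {𝒦 : Set (Set E3)} (hr : 0 < r)
    (hf : ContDiffOn ℝ 1 f ({x₀}ᶜ : Set E3)) (hpart : IsClusterPartition f x₀ r 𝒦) :
    0 ≤ clusterFlux f r 𝒦 :=
  le_trans (mul_nonneg hr.le (sphOsc_nonneg_offCentre hf.continuousOn hr)) (netFlux_le_clusterFlux hr hf hpart)

/-- **Density of the counted points.**  If `cellPred N₀ D` holds at every time of the window and `volume D = 0`, the points `(t,r)` of the
slab with `t ∉ D` and finitely many, at most `N₀`, cells on `S_r(x₀)` for `T(t)` are dense in `]t₀,0[ × ]0,∞[`. [folklore] -/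
theorem slab_subset_closure_counted (hD0 : volume D = 0) (hcell : ∀ t ∈ Ioo t₀ 0, cellPred N₀ D v x₀ T t) :
    Ioo t₀ 0 ×ˢ Ioi (0 : ℝ) ⊆ closure {p : ℝ × ℝ | p.1 ∈ Ioo t₀ 0 ∧ 0 < p.2 ∧ p.1 ∉ D ∧
      (cellSet (T p.1) x₀ p.2).Finite ∧ (cellSet (T p.1) x₀ p.2).ncard ≤ N₀} := by
  -- a Lebesgue-null set of reals misses a point of every nonempty open interval (cf. the landed
  -- `AxisymmetricKatoGlobal.EulerScaling.exists_mem_Ioo_not_mem_of_volume_eq_zero`, whose module lies in a Theses cone)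
  have aux : ∀ {N : Set ℝ}, volume N = 0 → ∀ {a b : ℝ}, a < b → ∃ x ∈ Ioo a b, x ∉ N := by
    intro N hN a b hab
    by_contra h
    push Not at h
    have h1 : volume (Ioo a b) ≤ volume N := measure_mono fun x hx => h x hx
    rw [hN, Real.volume_Ioo] at h1
    exact absurd h1 (not_le.2 (ENNReal.ofReal_pos.2 (by linarith)))
  rintro ⟨t, r⟩ htr
  obtain ⟨ht, hr0⟩ : t ∈ Ioo t₀ 0 ∧ 0 < r := htr
  rw [Metric.mem_closure_iff]
  intro ε hε
  -- a good time near `t`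
  have hab : max t₀ (t - ε / 2) < min 0 (t + ε / 2) :=
    max_lt (lt_min (ht.1.trans ht.2) (by linarith [ht.1])) (lt_min (by linarith [ht.2]) (by linarith))
  obtain ⟨t', ht', ht'D⟩ := aux hD0 hab
  have ht'W : t' ∈ Ioo t₀ 0 := ⟨(le_max_left _ _).trans_lt ht'.1, ht'.2.trans_le (min_le_left _ _)⟩
  have ht'1 : t - ε / 2 < t' := (le_max_right _ _).trans_lt ht'.1
  have ht'2 : t' < t + ε / 2 := ht'.2.trans_le (min_le_right _ _)
  obtain ⟨hfinP, htame⟩ := hcell t' ht'W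
  obtain ⟨-, B, -, hB0, hBN⟩ := htame ht'D
  -- a good radius near `r`
  have hab' : max (r / 2) (r - ε / 2) < r + ε / 2 := max_lt (by linarith) (by linarith)
  obtain ⟨r', hr', hr'B⟩ := aux hB0 hab'
  have hr'0 : 0 < r' := lt_of_lt_of_le (half_pos hr0) ((le_max_left _ _).trans hr'.1.le)
  have hr'1 : r - ε / 2 < r' := (le_max_right _ _).trans_lt hr'.1
  have hr'2 : r' < r + ε / 2 := hr'.2
  refine ⟨(t', r'), ⟨ht'W, hr'0, ht'D, (hfinP.2.2 r' hr'0).1, hBN r' hr'0 hr'B⟩, ?_⟩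
  rw [Prod.dist_eq]
  refine max_lt ?_ ?_
  · rw [Real.dist_eq, abs_lt]; constructor <;> linarith
  · rw [Real.dist_eq, abs_lt]; constructor <;> linarith

/-- ★ **The a-priori growth bound of the cluster flux of an admissible rule on the whole window.**  For data `v` smooth on `]t₀,0[ × ℝ³`,
`T` smooth off the centre, `‖curl v(t)‖ ≤ C₁/(−t)`, the link `curl v(t) = ∇T(t) × (· − x₀)`, `cellPred N₀ D` at every window time with
`volume D = 0`, and every admissible rule `𝒞`: `0 ≤ clusterFlux (T t) r (𝒞 t r) ≤ N₀ π C₁ r/(−t)` for all `t ∈ ]t₀,0[`, `r > 0`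
(Σ-0a = `ClusterFluxLeVorticity` enters as a hypothesis). [folklore] -/
theorem clusterFlux_window_growth (h₂ : ClusterFluxLeVorticity) {C₁ : ℝ} {𝒞 : ℝ → ℝ → Set (Set E3)}
    (hD0 : volume D = 0)
    (hv : ContDiffOn ℝ (⊤ : ℕ∞) (uncurry v) (Ioo t₀ 0 ×ˢ (univ : Set E3)))
    (hT : ContDiffOn ℝ (⊤ : ℕ∞) (uncurry T) (Ioo t₀ 0 ×ˢ ({x₀}ᶜ : Set E3)))
    (hωC : ∀ t ∈ Ioo t₀ 0, ∀ x, ‖curl (v t) x‖ ≤ C₁ / (-t))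
    (hlink : ∀ t ∈ Ioo t₀ 0, ∀ x, curl (v t) x = cross (gradient (T t) x) (x - x₀))
    (hcell : ∀ t ∈ Ioo t₀ 0, cellPred N₀ D v x₀ T t)
    (h𝒞 : AdmissibleRule x₀ T P V t₀ 𝒞) :
    ∀ t ∈ Ioo t₀ 0, ∀ r, 0 < r → 0 ≤ clusterFlux (T t) r (𝒞 t r) ∧
      clusterFlux (T t) r (𝒞 t r) ≤ (N₀ : ℝ) * Real.pi * C₁ * r / (-t) := by
  intro t ht r hr
  obtain ⟨hpart, -, hcont, hcnt⟩ := h𝒞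
  have hTs : ∀ s ∈ Ioo t₀ 0, ContDiffOn ℝ 1 (T s) ({x₀}ᶜ : Set E3) := fun s hs =>
    (contDiffOn_slice_compl hT hs).of_le (by exact_mod_cast le_top)
  have hvs : ∀ s ∈ Ioo t₀ 0, ContDiff ℝ 1 (v s) := fun s hs =>
    (contDiff_slice_of_window hv hs).of_le (by exact_mod_cast le_top)
  refine ⟨clusterFlux_nonneg_of_partition hr (hTs t ht) (hpart t ht r hr), ?_⟩
  -- the bound on the counted points
  set G : Set (ℝ × ℝ) := {p : ℝ × ℝ | p.1 ∈ Ioo t₀ 0 ∧ 0 < p.2 ∧ p.1 ∉ D ∧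
      (cellSet (T p.1) x₀ p.2).Finite ∧ (cellSet (T p.1) x₀ p.2).ncard ≤ N₀} with hG
  have hgood : ∀ q ∈ G, clusterFlux (T q.1) q.2 (𝒞 q.1 q.2) ≤ (N₀ : ℝ) * Real.pi * C₁ * q.2 / (-q.1) := by
    rintro ⟨s, ρ⟩ ⟨hs, hρ, -, hfin, hN⟩
    have h1 := h₂ (v s) x₀ (T s) ρ (C₁ / (-s)) (𝒞 s ρ) hρ (hvs s hs) (hTs s hs) (hlink s hs)
      (fun x _ => hωC s hs x) (hpart s hs ρ hρ)
    have hcount : ((𝒞 s ρ).ncard : ℝ) ≤ N₀ := by exact_mod_cast (hcnt s hs ρ hρ hfin).trans hN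
    have hK0 : 0 ≤ C₁ / (-s) := le_trans (norm_nonneg _) (hωC s hs x₀)
    have hπ : 0 ≤ Real.pi * ρ * (C₁ / (-s)) := by positivity
    calc clusterFlux (T s) ρ (𝒞 s ρ) ≤ ((𝒞 s ρ).ncard : ℝ) * (Real.pi * ρ * (C₁ / (-s))) := h1
      _ ≤ (N₀ : ℝ) * (Real.pi * ρ * (C₁ / (-s))) := mul_le_mul_of_nonneg_right hcount hπ
      _ = (N₀ : ℝ) * Real.pi * C₁ * ρ / (-s) := by ring
  -- the open box around `(t, r)` whose closure stays in the slab
  set U : Set (ℝ × ℝ) := Ioo ((t₀ + t) / 2) (t / 2) ×ˢ Ioo (r / 2) (r + 1) with hU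
  have hUo : IsOpen U := isOpen_Ioo.prod isOpen_Ioo
  have hmemU : ((t, r) : ℝ × ℝ) ∈ U := ⟨⟨by linarith [ht.1], by linarith [ht.2]⟩, ⟨by linarith, by linarith⟩⟩
  have hcl : ((t, r) : ℝ × ℝ) ∈ closure (U ∩ G) :=
    hUo.inter_closure ⟨hmemU, slab_subset_closure_counted hD0 hcell ⟨ht, hr⟩⟩
  have hUW : closure (U ∩ G) ⊆ Ioo t₀ 0 ×ˢ Ioi (0 : ℝ) := by
    refine (closure_mono inter_subset_left).trans ?_
    have hcU : closure U = Icc ((t₀ + t) / 2) (t / 2) ×ˢ Icc (r / 2) (r + 1) := by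
      rw [hU, closure_prod_eq, closure_Ioo (by linarith [ht.1, ht.2] : (t₀ + t) / 2 ≠ t / 2),
        closure_Ioo (by linarith : r / 2 ≠ r + 1)]
    rw [hcU]
    exact prod_mono (Icc_subset_Ioo (by linarith [ht.1]) (by linarith [ht.2]))
      fun ρ hρ => lt_of_lt_of_le (half_pos hr) hρ.1
  have hF : ContinuousOn (fun q : ℝ × ℝ => clusterFlux (T q.1) q.2 (𝒞 q.1 q.2)) (closure (U ∩ G)) := hcont.mono hUW
  have hB : ContinuousOn (fun q : ℝ × ℝ => (N₀ : ℝ) * Real.pi * C₁ * q.2 / (-q.1)) (closure (U ∩ G)) := by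
    refine ContinuousOn.div (by fun_prop) (by fun_prop) fun q hq => ?_
    have h : q.1 < 0 := (hUW hq).1.2
    exact (neg_pos.mpr h).ne'
  exact le_on_closure (fun q hq => hgood q hq.2) hF hB hcl

end Summit.NavierStokesRegularity.NavierStokesRegularity.Theorems.PoloidalLiouville.CellFlux

end
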